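import Summits.FinalStateConjecture.FinalStateConjecture.Theorems.EIHFluxBalanceInertialRecessionLorentz
import Summits.FinalStateConjecture.FinalStateConjecture.Theorems.EIHFluxBalanceInertialRecessionChartCalculus
import Literature.Geometry.Lorentzian.ImmersedChartRicci
import Literature.Geometry.Lorentzian.CoordTensorCovariance
import Literature.Geometry.Lorentzian.CauchyDevelopment

/-!
# Route EIHFluxBalance — `InertialRecession`, line `sublinear-is-free-clean-window-charges`:
# helpers for the slaving stub `stub_slaving`

Helper file for the crux `stmt-FinalStateConjecture-10166`
(`Summit.FinalStateConjecture.FinalStateConjecture.Theses.EIHFluxBalance.InertialRecession`),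
stub `stub_slaving` (painting rigidity / slaving of the painted moduli `(Λᵢ(t), ξᵢ(t))`).

Contents (all closed, no named facts):

* `contDiff_lorentz_symm` — the rest-frame map `t ↦ Λ(t)⁻¹` is as smooth as `t ↦ Λ(t)` (the
  `KINEMATICS` conjuncts of the stub are the landed file `…StubPaintedVelocityKinematics`).
* **Slaved moduli with zero error are inertial boosted Kerr** (`boostedKerrBilin_centre_add_smul`,
  `boostedKerrBilin_inertialCentre`): moving the centre event along the painted 4-velocity
  `u = Λe₀` does not change the painted Kerr–Schild field (stationarity of `g_{M,a}` in Kerr–Schild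
  time), so a hole painted with CONSTANT `Λ` and centre `ξ(s) = ξ₀ + (s − s₀) v(Λ)`,
  `v(Λ) = u~/u⁰`, has the stationary reference field `boostedKerrBilin Λ (s₀, ξ₀)` of a
  `FinalStateDecomposition` — the zero set of the slaving map.
* **Naturality of `ricAt`** (`ricAt_pullMetric`, generic `E`): `ricAt (ψ^*G) y (Y,Z) =
  ricAt G (ψ y) (DψY, DψZ)` for a change of coordinates `ψ` (trace of the conjugation
  `Dψ ∘ R' = R ∘ Dψ`, `MetricCoord.IsMetricOn.fderiv_riemAt_pullMetric`) — with the inertial-centre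
  identity this transports `Ric(g_{M,a}) = 0` to the painted (Poincaré-moved) summands.
* **The Ricci bridge** (`ricAt_deviationExtend_add_bilin_eq_zero`): for a smooth chart map
  `Φ : U → 𝓢` of a RICCI-FLAT spacetime whose differential is injective on an open `A ≤ U`, the
  coordinate Ricci form (`MetricCoord.ricAt`, `CoordCurvature.lean`) of the lab components
  `z ↦ (Φ^*g − g₀)(z) + g₀(z)` vanishes on `A` (naturality of `Ric` under the local isometry
  `(A, Φ^*g) → (𝓢, g)`, `ricci_comap_apply`, and `OpensChart.ricci_eq_ricAt`). That `dΦ` IS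
  injective near each hole at late times (from `C⁰`-smallness of the deviation and coercivity of
  the painted Kerr–Schild summands) is the companion file `…StubSlavingCoercivity`
  (`eventually_injective_mfderiv_near_hole`); together this is how `Ric(Φ^*g) = 0` is read in the
  lab chart of the crux hypothesis.
-/

set_option linter.dupNamespace false

noncomputable section

open scoped Topology Manifold ContDiff
open Filter Set Function Module TopologicalSpace Literature.Geometry.Lorentzian
  Summit.FinalStateConjecture.FinalStateConjecture.Theorems

namespace Summit.FinalStateConjecture.FinalStateConjecture.Theorems.SublinearIsFree.Slaving

/-! ### Smoothness of the rest-frame map -/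

/-- **The inverse motion is as smooth as the motion**: if `t ↦ Λ(t)` is `Cⁿ` as a path of
operators then so is `t ↦ Λ(t)⁻¹` (inversion is smooth on invertible operators,
`contDiffAt_map_inverse`). This converts the smoothness clause of the crux antecedent into the
form consumed by the ansatz estimates (`exists_norm_iteratedFDeriv_ansatzSummand_le`, which are
phrased through the rest-frame map `Λ(t)⁻¹`). [folklore] -/
theorem contDiff_lorentz_symm {n : WithTop ℕ∞} {Λ : ℝ → lorentzGroup}
    (hΛ : ContDiff ℝ n (fun t ↦ ((Λ t : E4 ≃L[ℝ] E4) : E4 →L[ℝ] E4))) :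
    ContDiff ℝ n (fun t ↦ (((Λ t : E4 ≃L[ℝ] E4).symm : E4 →L[ℝ] E4))) := by
  have h : (fun t ↦ (((Λ t : E4 ≃L[ℝ] E4).symm : E4 →L[ℝ] E4))) =
      ContinuousLinearMap.inverse ∘ (fun t ↦ ((Λ t : E4 ≃L[ℝ] E4) : E4 →L[ℝ] E4)) :=
    funext fun t ↦ (ContinuousLinearMap.inverse_equiv (Λ t : E4 ≃L[ℝ] E4)).symm
  rw [h]
  exact contDiff_iff_contDiffAt.2 fun t ↦ (contDiffAt_map_inverse (Λ t : E4 ≃L[ℝ] E4)).comp t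
    hΛ.contDiffAt

/-! ### Zero slaving error: inertial centres give the stationary boosted Kerr–Schild field -/

/-- Moving the centre event along the painted 4-velocity `u = Λe₀` shifts the rest-frame position
by a multiple of `e₀`: `Λ⁻¹(x − (c + s u)) = Λ⁻¹(x − c) − s e₀` (O'Neill 1983, Ch. 9, p. 236).
[folklore] -/
theorem poincareInv_centre_add_smul (Λ : lorentzGroup) (c x : E4) (s : ℝ) :
    poincareInv Λ (c + s • (Λ : E4 ≃L[ℝ] E4) (E4.basisVector 0)) x =
      poincareInv Λ c x - s • E4.basisVector 0 := by
  simp only [poincareInv, sub_add_eq_sub_sub, map_sub, map_smul,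
    ContinuousLinearEquiv.symm_apply_apply]

/-- **The painted Kerr–Schild field does not see translations of the centre event along the
painted 4-velocity**: `boostedKerrBilin Λ (c + s Λe₀) = boostedKerrBilin Λ c` (stationarity of
`g_{M,a}` in Kerr–Schild time, Kerr–Schild 1965, §2). [folklore] -/
theorem boostedKerrBilin_centre_add_smul (Λ : lorentzGroup) (c : E4) (s M a : ℝ) (x : E4) :
    boostedKerrBilin Λ (c + s • (Λ : E4 ≃L[ℝ] E4) (E4.basisVector 0)) M a x =
      boostedKerrBilin Λ c M a x := by
  have h0 : E4.spatial (E4.basisVector 0) = 0 := by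
    ext i
    simp [E4.spatial_apply, Fin.succ_ne_zero]
  have hsp : E4.spatial (poincareInv Λ (c + s • (Λ : E4 ≃L[ℝ] E4) (E4.basisVector 0)) x) =
      E4.spatial (poincareInv Λ c x) := by
    rw [poincareInv_centre_add_smul, map_sub, map_smul, h0, smul_zero, sub_zero]
  ext v w
  rw [boostedKerrBilin_apply, boostedKerrBilin_apply, kerr_bilin_eq_of_spatial_eq M a hsp]

/-- The lab event `(s, ξ₀ + (s − s₀) v)` on the inertial world-line with velocity `v = u~/u⁰`
through `(s₀, ξ₀)` is `(s₀, ξ₀) + ((s − s₀)/u⁰) u` (coordinate bookkeeping). [folklore] -/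
theorem ofTimeSpace_inertialCentre (u : E4) (hu : u 0 ≠ 0) (s₀ s : ℝ) (ξ₀ : E3) :
    E4.ofTimeSpace s (ξ₀ + (s - s₀) • ((u 0)⁻¹ • E4.spatial u)) =
      E4.ofTimeSpace s₀ ξ₀ + ((s - s₀) * (u 0)⁻¹) • u := by
  ext i
  refine Fin.cases ?_ (fun j ↦ ?_) i
  · simp only [E4.ofTimeSpace_apply_zero, PiLp.add_apply, PiLp.smul_apply, smul_eq_mul]
    field_simp
    ring
  · simp only [E4.ofTimeSpace_apply_succ, PiLp.add_apply, PiLp.smul_apply, smul_eq_mul,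
      E4.spatial_apply]
    ring

/-- **Zero slaving error is inertial boosted Kerr.** A hole painted with a CONSTANT Lorentz map
`Λ` and the inertial centre `ξ(s) = ξ₀ + (s − s₀) v(Λ)`, `v(Λ) = (Λe₀)~/(Λe₀)⁰` — i.e. with
`ξ̇ − v(Λ) = 0`, `u̇ = 0` — has, at every lab time `s`, the STATIONARY boosted Kerr–Schild
reference field of a `FinalStateDecomposition` with motion `(Λ, (s₀, ξ₀))`:
`boostedKerrBilin Λ (s, ξ(s)) M a = boostedKerrBilin Λ (s₀, ξ₀) M a` (Kerr–Schild 1965, §2: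
Lorentz covariance and stationarity of the Kerr–Schild form). [folklore] -/
theorem boostedKerrBilin_inertialCentre (Λ : lorentzGroup) (s₀ : ℝ) (ξ₀ : E3) (M a s : ℝ)
    (x : E4) :
    boostedKerrBilin Λ (E4.ofTimeSpace s (ξ₀ + (s - s₀) •
        ((((Λ : E4 ≃L[ℝ] E4) (E4.basisVector 0)) 0)⁻¹ •
          E4.spatial ((Λ : E4 ≃L[ℝ] E4) (E4.basisVector 0))))) M a x =
      boostedKerrBilin Λ (E4.ofTimeSpace s₀ ξ₀) M a x := by
  have h0 : ((Λ : E4 ≃L[ℝ] E4) (E4.basisVector 0)) 0 ≠ 0 := fun h ↦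
    absurd (one_le_abs_lorentz_apply_zero Λ) (by rw [h, abs_zero]; norm_num)
  rw [ofTimeSpace_inertialCentre _ h0, boostedKerrBilin_centre_add_smul]

/-! ### Naturality of the coordinate Ricci form under changes of coordinates -/

section RicciCovariance

variable {E : Type*} [NormedAddCommGroup E] [NormedSpace ℝ E] [FiniteDimensional ℝ E]
  [CompleteSpace E] {G : E → E →L[ℝ] E →L[ℝ] ℝ} {ψ : E → E} {V V' : Set E} {y : E}

/-- **The curvature endomorphism is natural under changes of coordinates, on all vectors**:
`Dψ (R'(X,Y)Z) = R(Dψ X, Dψ Y)(Dψ Z)` (trilinear extension of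
`MetricCoord.IsMetricOn.fderiv_riemAt_pullMetric`; O'Neill 1983, Ch. 3, Prop. 3.59 (2)). [folklore] -/
theorem fderiv_riemAt_pullMetric_apply (hG : MetricCoord.IsMetricOn G V)
    (hψ : MetricCoord.IsCoordChangeOn ψ V' V) (hy : y ∈ V') (X Y Z : E) :
    fderiv ℝ ψ y (MetricCoord.riemAt (MetricCoord.pullMetric G ψ) y X Y Z) =
      MetricCoord.riemAt G (ψ y) (fderiv ℝ ψ y X) (fderiv ℝ ψ y Y) (fderiv ℝ ψ y Z) := by
  classical
  set b := Module.finBasis ℝ E with hb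
  set D : E →L[ℝ] E := fderiv ℝ ψ y with hD
  set G' := MetricCoord.pullMetric G ψ with hG'
  -- (1) basis triples
  have h1 : ∀ j k i, D (MetricCoord.riemAt G' y (b j) (b k) (b i)) =
      MetricCoord.riemAt G (ψ y) (D (b j)) (D (b k)) (D (b i)) :=
    fun j k i ↦ hG.fderiv_riemAt_pullMetric hψ hy j k i
  -- (2) the third slot is linear
  have h2 : ∀ j k (Z : E), D (MetricCoord.riemAt G' y (b j) (b k) Z) =
      MetricCoord.riemAt G (ψ y) (D (b j)) (D (b k)) (D Z) := by
    intro j k Z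
    have h : ((D.comp (MetricCoord.riemAt G' y (b j) (b k)) : E →L[ℝ] E) : E →ₗ[ℝ] E) =
        (((MetricCoord.riemAt G (ψ y) (D (b j)) (D (b k))).comp D : E →L[ℝ] E) : E →ₗ[ℝ] E) :=
      b.ext fun i ↦ by
        simp only [ContinuousLinearMap.coe_coe, ContinuousLinearMap.comp_apply]
        exact h1 j k i
    exact LinearMap.congr_fun h Z
  -- (3) the first slot is linear (`ricciEndo`)
  have h3 : ∀ k (X Z : E), D (MetricCoord.riemAt G' y X (b k) Z) =
      MetricCoord.riemAt G (ψ y) (D X) (D (b k)) (D Z) := by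
    intro k X Z
    have h : (D : E →ₗ[ℝ] E) ∘ₗ MetricCoord.ricciEndo G' y (b k) Z =
        MetricCoord.ricciEndo G (ψ y) (D (b k)) (D Z) ∘ₗ (D : E →ₗ[ℝ] E) :=
      b.ext fun j ↦ by
        simp only [LinearMap.comp_apply, MetricCoord.ricciEndo_apply, ContinuousLinearMap.coe_coe]
        exact h2 j k Z
    have := LinearMap.congr_fun h X
    simpa only [LinearMap.comp_apply, MetricCoord.ricciEndo_apply, ContinuousLinearMap.coe_coe]
      using this
  -- (4) the second slot is linear (swap to the first)
  have h : (D : E →ₗ[ℝ] E) ∘ₗ MetricCoord.ricciEndo G' y Y Z =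
      MetricCoord.ricciEndo G (ψ y) (D Y) (D Z) ∘ₗ (D : E →ₗ[ℝ] E) :=
    b.ext fun k ↦ by
      simp only [LinearMap.comp_apply, MetricCoord.ricciEndo_apply, ContinuousLinearMap.coe_coe]
      rw [MetricCoord.riemAt_swap G' y Y (b k), MetricCoord.riemAt_swap G (ψ y) (D Y) (D (b k)),
        neg_apply, neg_apply, map_neg, h3]
  have := LinearMap.congr_fun h X
  simpa only [LinearMap.comp_apply, MetricCoord.ricciEndo_apply, ContinuousLinearMap.coe_coe]
    using this

/-- **The coordinate Ricci form is natural under changes of coordinates**: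
`ricAt (ψ^*G) y (Y, Z) = ricAt G (ψ y) (Dψ Y, Dψ Z)` — the endomorphism `X ↦ R'(X,Y)Z` is
conjugate by `Dψ_y` to `X' ↦ R(X', DψY)(DψZ)`, so the traces agree (O'Neill 1983, Ch. 3,
Prop. 3.59 and Lemma 3.52). [folklore] -/
theorem ricAt_pullMetric (hG : MetricCoord.IsMetricOn G V)
    (hψ : MetricCoord.IsCoordChangeOn ψ V' V) (hy : y ∈ V') (Y Z : E) :
    MetricCoord.ricAt (MetricCoord.pullMetric G ψ) y Y Z =
      MetricCoord.ricAt G (ψ y) (fderiv ℝ ψ y Y) (fderiv ℝ ψ y Z) := by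
  obtain ⟨e, he⟩ := hψ.isInvertible y hy
  rw [MetricCoord.ricAt_apply, MetricCoord.ricAt_apply]
  set R' := MetricCoord.ricciEndo (MetricCoord.pullMetric G ψ) y Y Z with hR'
  set R := MetricCoord.ricciEndo G (ψ y) (fderiv ℝ ψ y Y) (fderiv ℝ ψ y Z) with hR
  have hconj : ((e : E →L[ℝ] E) : E →ₗ[ℝ] E) ∘ₗ R' = R ∘ₗ ((e : E →L[ℝ] E) : E →ₗ[ℝ] E) := by
    refine LinearMap.ext fun X ↦ ?_
    simp only [LinearMap.comp_apply, ContinuousLinearMap.coe_coe, hR', hR,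
      MetricCoord.ricciEndo_apply, he]
    exact fderiv_riemAt_pullMetric_apply hG hψ hy X Y Z
  have hR'eq : R' = ((e.symm : E →L[ℝ] E) : E →ₗ[ℝ] E) ∘ₗ (R ∘ₗ ((e : E →L[ℝ] E) : E →ₗ[ℝ] E)) := by
    rw [← hconj, ← LinearMap.comp_assoc]
    refine LinearMap.ext fun X ↦ ?_
    simp
  rw [hR'eq, LinearMap.trace_comp_comm', LinearMap.comp_assoc]
  congr 1
  refine LinearMap.ext fun X ↦ ?_
  simp

end RicciCovariance

/-! ### Reading `Ric(g) = 0` in the lab chart: the Ricci bridge -/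

section RicciBridge

variable (𝓢 : Spacetime 4)

/-- **The Ricci bridge.** Let `𝓢` be a Ricci-flat spacetime (hypothesis in the shape of the field
`VacuumCauchyDevelopment.isRicciFlat`), `Φ : U → 𝓢` a smooth chart map on a reference background
with domain `U`, and `A ≤ U` an open set on which `dΦ` is injective. Then the coordinate Ricci form
of the lab components `z ↦ (Φ^*g − g₀)(z) + g₀(z)` (`= (Φ^*g)(z)` on `U`; `MetricCoord.ricAt` of
`CoordCurvature.lean`) vanishes on `A`: `(A, Φ^*g)` is a pseudo-Riemannian open submanifold of `E4`
locally isometric to `(𝓢, g)` along `Φ`, so its Ricci tensor is `Φ^* Ric(g) = 0`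
(`ricci_comap_apply`, O'Neill 1983, Ch. 3, Prop. 3.59) and equals `ricAt` of its components
(`OpensChart.ricci_eq_ricAt`, O'Neill 1983, Ch. 3, Lemma 3.52). [folklore] -/
theorem ricAt_deviationExtend_add_bilin_eq_zero
    (hRic : ∀ [𝓢.metric.toPseudoRiemannianMetric.HasLeviCivita],
      𝓢.metric.toPseudoRiemannianMetric.IsRicciFlat)
    (B : ModelBackground) {Φ : B.domain → 𝓢.carrier}
    (hΦ : ContMDiff 𝓘(ℝ, E4) (𝓡 4) ∞ Φ) {A : Opens E4} (hA : A ≤ B.domain)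
    (hinj : ∀ y : A, Function.Injective (mfderiv 𝓘(ℝ, E4) (𝓡 4) Φ (Opens.inclusion hA y)))
    (y : A) (v w : E4) :
    MetricCoord.ricAt (fun z ↦ 𝓢.deviationExtend B Φ z + B.bilin z) y.1 v w = 0 := by
  haveI : 𝓢.metric.toPseudoRiemannianMetric.HasLeviCivita :=
    𝓢.metric.toPseudoRiemannianMetric.hasLeviCivita
  have hΦd : MDifferentiable 𝓘(ℝ, E4) (𝓡 4) Φ := hΦ.mdifferentiable (by simp)
  have hid : MDifferentiable 𝓘(ℝ, E4) 𝓘(ℝ, E4) (Opens.inclusion hA) :=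
    (contMDiff_inclusion (n := ∞) hA).mdifferentiable (by simp)
  -- the chart map restricted to the open submanifold `A`
  have hΦ' : ContMDiff 𝓘(ℝ, E4) (𝓡 4) (∞ + 1) (Φ ∘ Opens.inclusion hA) := by
    have h : ((∞ : ℕ∞ω) + 1) = ∞ := rfl
    rw [h]
    exact hΦ.comp (contMDiff_inclusion hA)
  have hmf : ∀ (z : A) (u : E4), mfderiv 𝓘(ℝ, E4) (𝓡 4) (Φ ∘ Opens.inclusion hA) z u =
      mfderiv 𝓘(ℝ, E4) (𝓡 4) Φ (Opens.inclusion hA z) u := by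
    intro z u
    have hc := mfderiv_comp z (hΦd (Opens.inclusion hA z)) (hid z)
    rw [hc]
    exact congrArg (mfderiv 𝓘(ℝ, E4) (𝓡 4) Φ (Opens.inclusion hA z))
      (OpensChart.mfderiv_inclusion_apply hA z u)
  have hinj' : ∀ z : A,
      Function.Injective (mfderiv 𝓘(ℝ, E4) (𝓡 4) (Φ ∘ Opens.inclusion hA) z) := by
    intro z u u' h
    rw [hmf, hmf] at h
    exact hinj z h
  have hdim : Module.finrank ℝ E4 = Module.finrank ℝ (EuclideanSpace ℝ (Fin 4)) := rfl
  set g' := 𝓢.metric.toPseudoRiemannianMetric.comap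
    PseudoRiemannianMetric.contMDiff_pullbackBilin_holds (Φ ∘ Opens.inclusion hA) hΦ' hinj' hdim
    with hg'
  haveI : g'.HasLeviCivita := g'.hasLeviCivita
  -- its representative is the lab component field
  have hrepr : ∀ z : A, g'.val z = (fun z ↦ 𝓢.deviationExtend B Φ z + B.bilin z) z.1 := by
    intro z
    have e2 : 𝓢.deviationExtend B Φ z.1 = 𝓢.deviation B Φ (Opens.inclusion hA z) :=
      𝓢.deviationExtend_coe B Φ (Opens.inclusion hA z)
    rw [hg', PseudoRiemannianMetric.val_comap]
    ext u u'
    rw [pullbackBilin_apply, hmf, hmf]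
    change _ = (𝓢.deviationExtend B Φ z.1 + B.bilin z.1) u u'
    rw [add_apply, add_apply, e2, 𝓢.deviation_apply, sub_add_cancel]
    rfl
  rw [← OpensChart.ricci_eq_ricAt hrepr y v w,
    𝓢.metric.toPseudoRiemannianMetric.ricci_comap_apply
      PseudoRiemannianMetric.contMDiff_pullbackBilin_holds hΦ' hinj' hdim y v w]
  have h0 : 𝓢.metric.toPseudoRiemannianMetric.ricci ((Φ ∘ Opens.inclusion hA) y) = 0 := hRic _
  rw [h0]
  rfl

end RicciBridge

/-- **The Ricci bridge for a vacuum Cauchy development** (the crux's `𝒟`): in the lab chart `Φ` of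
the crux hypothesis, `ricAt ((Φ^*g − g₀) + g₀) = 0` wherever `dΦ` is injective — the Einstein
vacuum equations `VacuumCauchyDevelopment.isRicciFlat` read in coordinates. [folklore] -/
theorem ricAt_deviationExtend_add_bilin_eq_zero_of_vacuum
    {X : Type*} [TopologicalSpace X] [ChartedSpace E3 X] [IsManifold (𝓡 3) ∞ X]
    [ConnectedSpace X] {D : InitialDataSet (𝓡 3) X} (𝒟 : VacuumCauchyDevelopment D)
    (B : ModelBackground) {Φ : B.domain → 𝒟.carrier}
    (hΦ : ContMDiff 𝓘(ℝ, E4) (𝓡 4) ∞ Φ) {A : Opens E4} (hA : A ≤ B.domain)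
    (hinj : ∀ y : A, Function.Injective (mfderiv 𝓘(ℝ, E4) (𝓡 4) Φ (Opens.inclusion hA y)))
    (y : A) (v w : E4) :
    MetricCoord.ricAt (fun z ↦ 𝒟.toSpacetime.deviationExtend B Φ z + B.bilin z) y.1 v w = 0 :=
  ricAt_deviationExtend_add_bilin_eq_zero 𝒟.toSpacetime 𝒟.isRicciFlat B hΦ hA hinj y v w

/-- **Registered sub-goal form** (stub `slaving_ricAt_labMetric_eq_zero_of_vacuum` of the crux item)
of `ricAt_deviationExtend_add_bilin_eq_zero_of_vacuum`: the Einstein vacuum equations of a vacuum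
Cauchy development read in a lab chart, wherever the chart differential is injective. [folklore] -/
theorem slaving_ricAt_labMetric_eq_zero_of_vacuum : open Literature.Geometry.Lorentzian in ∀ {X : Type} [TopologicalSpace X] [ChartedSpace E3 X] [IsManifold (𝓡 3) ((⊤ : ℕ∞) : WithTop ℕ∞) X] [ConnectedSpace X] {D : InitialDataSet (𝓡 3) X} (𝒟 : VacuumCauchyDevelopment D) (B : ModelBackground) {Φ : B.domain → 𝒟.carrier}, ContMDiff 𝓘(ℝ, E4) (𝓡 4) ((⊤ : ℕ∞) : WithTop ℕ∞) Φ → ∀ {A : Opens E4} (hA : A ≤ B.domain), (∀ y : A, Function.Injective (mfderiv 𝓘(ℝ, E4) (𝓡 4) Φ (Opens.inclusion hA y))) → ∀ (y : A) (v w : E4), MetricCoord.ricAt (fun z ↦ 𝒟.toSpacetime.deviationExtend B Φ z + B.bilin z) y.1 v w = 0 :=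
  fun 𝒟 B _ hΦ _ hA hinj y v w ↦ ricAt_deviationExtend_add_bilin_eq_zero_of_vacuum 𝒟 B hΦ hA hinj y v w

end Summit.FinalStateConjecture.FinalStateConjecture.Theorems.SublinearIsFree.Slaving

end
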